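/-
Copyright (c) 2026. All rights reserved.
Released under Apache 2.0 license as described in the file LICENSE.
-/
import Summits.AtomisticToContinuum.Crystallization.Theorems.ChartedZeroExcessLayeredLatticeLiouvilleVK

/-!
# ChartedZeroExcessLayeredLatticeLiouville — part VL «ChainCoercive III»: ★★ `chainCoercive_of_coerciveZ` — the laminate's `CoerciveZ` passes to its chain
  (decomp-a2c-lens-2, g57; helper of stmt-AtomisticToContinuum-26636, leaf (LD′) `ModalLipschitzZ`; brick (b1) of critic rows 915/919, signature of record row 923 (iii))

* VL.1 the DATA of record (row 923 (P2)/(P3)): `chainDirichlet S cf = Σ_{α ∈ S ∪ (S − 1)} ‖cf (α+1) − cf α‖²` (every nearest-layer increment meeting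
  `S ⊇ supp cf`) and `chainForm c ϱ a b w S cf = Σ_{α, β ∈ layerCollar S ⌊ϱ/c⌋₊} chainT cf α β`; the band-closedness of the collar and the
  `W`-INDEPENDENCE `chainForm_eq_sum` (any band-closed `W ⊇ S` gives the same double sum — no vacuity in the choice of `W`);
* VL.2 `chain_finiteVolume_ineq`: `(2κ₀ − ε)(2R_c+1)²·D_T ≤ (2ρ+1)²·Q̄ + 8r(2ρ+2r+1)·#collar·(2r+1)³F(c)(2m)²` (`R_c = ρ + r`; VJ lower bound + VK rows +
  UT `truncForm_coercive`), and ★★ `chainCoercive_of_coerciveZ_sum` / `chainCoercive_of_coerciveZ`: dividing by `(2R_c+1)²` and letting `ρ → ∞` (an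
  Archimedean contradiction) gives `(2κ₀ − ε) · chainDirichlet S cf ≤ chainForm c ϱ a b w S cf` for every finitely supported profile — the 1D chain
  operator inherits the 3D certificate's constant in the nearest-layer currency (row 923 (ii): ASK (α) YES); the tail hypothesis is the literal
  `∀ φ, HasFiniteSupport φ → …` clause of `TailDominationCert` (`tailHyp_of_cert`, row 923 (P1)).
The sign hypothesis `ε ≤ 2κ₀` is used because the lower bound DROPS the in-plane part of `nnFormZ χ_ρ` (the sharp constant would be `18(2κ₀ − ε)`); in the
regime of (T) (`ε` small) it is free.
-/

namespace Summit.AtomisticToContinuum.Crystallization.Theorems.ChartedZeroExcessLayeredLatticeLiouville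

open Summit.AtomisticToContinuum.Crystallization.Theorems.ChartedPlanarOrderRigidityDoor (E3)
open Finset

noncomputable section ChainCoerciveIII

variable {c : ℝ} {a b : E3} {w : ℤ → E3}

/-! ### VL.1  The data of record: `chainDirichlet`, `chainForm`, and the independence of the layer window -/

/-- the CHAIN DIRICHLET ENERGY of a profile relative to a layer set `S ⊇ supp cf`: all nearest-layer increments meeting `S`,
`Σ_{α ∈ S ∪ (S − 1)} ‖cf (α+1) − cf α‖²` (for `supp cf ⊆ S` this is the full `Σ_α ‖cf (α+1) − cf α‖²`). [this file, g57] -/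
def chainDirichlet (S : Finset ℤ) (cf : ℤ → E3) : ℝ :=
  ∑ α ∈ S ∪ S.image (fun α => α - 1), ‖cf (α + 1) - cf α‖ ^ 2

/-- the CHAIN QUADRATIC FORM of a profile: `Σ_{α, β ∈ layerCollar S ⌊ϱ/c⌋₊} ⟪cf β − cf α, chainK (0, α) β (cf β − cf α)⟫` — by `chainForm_eq_sum` the
same double sum over every band-closed layer set containing `S`. [this file, g57] -/
def chainForm (c ϱ : ℝ) (a b : E3) (w : ℤ → E3) (S : Finset ℤ) (cf : ℤ → E3) : ℝ :=
  ∑ α ∈ layerCollar S ⌊ϱ / c⌋₊, ∑ β ∈ layerCollar S ⌊ϱ / c⌋₊, chainT ϱ a b w cf α β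

/-- `S ⊆ layerCollar S r`. [formal bookkeeping] -/
theorem subset_layerCollar (S : Finset ℤ) (r : ℕ) : S ⊆ layerCollar S r := fun α hα =>
  mem_layerCollar_of hα (by rw [sub_self]; exact Nat.zero_le _)

/-- the layer collar of radius `⌊ϱ/c⌋₊` is closed under the band `c|β − α| ≤ ϱ` around `S`. [formal bookkeeping] -/
theorem mem_layerCollar_of_band (hc : 0 < c) {ϱ : ℝ} {S : Finset ℤ} {α : ℤ} (hα : α ∈ S) (β : ℤ)
    (h : c * |(((β - α : ℤ)) : ℝ)| ≤ ϱ) : β ∈ layerCollar S ⌊ϱ / c⌋₊ := by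
  refine mem_layerCollar_of hα (Nat.le_floor ?_)
  rw [le_div_iff₀ hc, mul_comm, Nat.cast_natAbs, Int.cast_abs]
  exact h

/-- ★ `W`-INDEPENDENCE: over every band-closed layer set `W ⊇ S ⊇ supp cf` the double chain sum is `chainForm` (entries outside the band or off the
support vanish, VK `mem_of_chainT_ne_zero`). [this file, g57] -/
theorem chainForm_eq_sum (hc : 0 < c) (hL : IsLayeredCrystal c a b w) {ϱ : ℝ} {cf : ℤ → E3} {S W : Finset ℤ}
    (hS : ∀ α, α ∉ S → cf α = 0) (hSW : S ⊆ W) (hW : ∀ α ∈ S, ∀ β : ℤ, c * |(((β - α : ℤ)) : ℝ)| ≤ ϱ → β ∈ W) :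
    chainForm c ϱ a b w S cf = ∑ α ∈ W, ∑ β ∈ W, chainT ϱ a b w cf α β := by
  unfold chainForm
  have hC := subset_layerCollar S ⌊ϱ / c⌋₊
  have hCb : ∀ α ∈ S, ∀ β : ℤ, c * |(((β - α : ℤ)) : ℝ)| ≤ ϱ → β ∈ layerCollar S ⌊ϱ / c⌋₊ :=
    fun α hα β h => mem_layerCollar_of_band hc hα β h
  have hinner : ∀ α, ∑ β ∈ layerCollar S ⌊ϱ / c⌋₊, chainT ϱ a b w cf α β = ∑ β ∈ W, chainT ϱ a b w cf α β := fun α =>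
    sum_eq_sum_of_support (fun β hβ => (mem_of_chainT_ne_zero hc hL hS hC hCb hβ).2)
      (fun β hβ => (mem_of_chainT_ne_zero hc hL hS hSW hW hβ).2)
  simp only [hinner]
  refine sum_eq_sum_of_support (fun α hα => ?_) (fun α hα => ?_)
  · obtain ⟨β, _, hβ⟩ := exists_ne_zero_of_sum_ne_zero hα
    exact (mem_of_chainT_ne_zero hc hL hS hC hCb hβ).1
  · obtain ⟨β, _, hβ⟩ := exists_ne_zero_of_sum_ne_zero hα
    exact (mem_of_chainT_ne_zero hc hL hS hSW hW hβ).1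

/-- the tail hypothesis of the chain-coercivity theorem is the LITERAL clause of `TailDominationCert` (UT `tailFam` is its summand by definition).
[formal bookkeeping] -/
theorem tailHyp_of_cert (hTD : TailDominationCert) (hc : 0 < c) {ε : ℝ} (hε : 0 < ε) :
    ∃ ϱ₀ : ℝ, 0 < ϱ₀ ∧ ∀ ϱ : ℝ, ϱ₀ ≤ ϱ → ∀ (a b : E3) (w : ℤ → E3), IsLayeredCrystal c a b w →
      ∀ φ : Cell 2 → ℤ → E3, HasFiniteSupport φ → Summable (tailFam ϱ a b w φ) ∧ ∑' x, tailFam ϱ a b w φ x ≤ ε * nnFormZ φ :=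
  hTD c hc ε hε

/-! ### VL.2  The finite-volume inequality and ★ chain coercivity from `CoerciveZ` -/

/-- the FINITE-VOLUME INEQUALITY: for `ρ` so large that `S ⊆ (−(ρ+r), ρ+r)` shifted by one, testing `CoerciveZ` on the cut profile of radius `R_c = ρ + r` gives
`(2κ₀ − ε)(2R_c+1)²·D_T ≤ (2ρ+1)²·Q̄_W + 8r·#collar·(2r+1)³F(c)(2m)² · (2R_c+1)`. [this file, g57] -/
theorem chain_finiteVolume_ineq (hc : 0 < c) (hL : IsLayeredCrystal c a b w) {κ₀ ε ϱ : ℝ} (hϱ : 0 ≤ ϱ) (hε : ε ≤ 2 * κ₀)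
    (hK : CoerciveZ (layeredKernel a b w) κ₀)
    (hT : ∀ φ : Cell 2 → ℤ → E3, HasFiniteSupport φ → Summable (tailFam ϱ a b w φ) ∧ ∑' x, tailFam ϱ a b w φ x ≤ ε * nnFormZ φ)
    {cf : ℤ → E3} {S W : Finset ℤ} (hS : ∀ α, α ∉ S → cf α = 0) (hSW : S ⊆ W)
    (hW : ∀ α ∈ S, ∀ β : ℤ, c * |(((β - α : ℤ)) : ℝ)| ≤ ϱ → β ∈ W) {m : ℝ} (hm : ∀ α, ‖cf α‖ ≤ m) (T : Finset ℤ)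
    {ρ : ℕ} (hρ : ∀ α ∈ S, α.natAbs + 1 ≤ ρ) :
    (2 * κ₀ - ε) * ((((2 * (ρ + ⌊ϱ / c⌋₊) + 1 : ℕ)) : ℝ) ^ 2 * ∑ α ∈ T, ‖cf (α + 1) - cf α‖ ^ 2) ≤
      (((2 * ρ + 1) ^ 2 : ℕ) : ℝ) * ∑ α ∈ W, ∑ β ∈ W, chainT ϱ a b w cf α β +
        ((8 * ⌊ϱ / c⌋₊ * (2 * ρ + 2 * ⌊ϱ / c⌋₊ + 1) * (layerCollar S ⌊ϱ / c⌋₊).card : ℕ) : ℝ) *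
          ((((2 * ⌊ϱ / c⌋₊ + 1) ^ 3 : ℕ) : ℝ) * (kernelConst c * (2 * m) ^ 2)) := by
  set r := ⌊ϱ / c⌋₊ with hr
  set Rc := ρ + r with hRc
  set χ := cutProfile (planarBall Rc) cf with hχdef
  set P := nearSet hc hL ϱ (planarBall Rc ×ˢ S) with hP
  have hχ : ∀ X : Cell 2 × ℤ, X ∉ planarBall Rc ×ˢ S → χ X.1 X.2 = 0 := cutProfile_eq_zero_of_not_mem hS
  have hfs : HasFiniteSupport χ := ⟨planarBall Rc ×ˢ S, fun γ α h => hχ (γ, α) h⟩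
  -- (i) coercivity on the cut profile, split into deep and collar rows
  have hco := truncForm_coercive hc hL hK hχ (hT χ hfs)
  rw [sum_product, ← sum_filter_add_sum_filter_not P (fun p => p.1 ∈ planarBall ρ), deep_total_eq hc hL hϱ hS hSW hW ρ] at hco
  have hrest := (le_abs_self _).trans (rest_total_le hc hL hϱ cf S hm ρ)
  -- (ii) the lower bound: `(2R_c+1)² D_T ≤ idxEnergy χ (idxBall 0 R_c) ≤ nnFormZ χ`
  have hvan : ∀ α, ‖cf (α + 1) - cf α‖ ^ 2 ≠ 0 → -(Rc : ℤ) ≤ α ∧ α < Rc := by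
    intro α hα
    by_cases h1 : α ∈ S
    · have := hρ α h1; omega
    by_cases h2 : α + 1 ∈ S
    · have := hρ (α + 1) h2; omega
    exact absurd (by rw [hS α h1, hS (α + 1) h2, sub_zero, norm_zero, zero_pow two_ne_zero]) hα
  have hlow : ((((2 * Rc + 1 : ℕ)) : ℝ)) ^ 2 * ∑ α ∈ T, ‖cf (α + 1) - cf α‖ ^ 2 ≤ nnFormZ χ := by
    have h1 := sum_le_sum_range_shift (g := fun α => ‖cf (α + 1) - cf α‖ ^ 2) (fun α => sq_nonneg _) hvan T
    have h2 := sq_mul_sum_le_idxEnergy_cutProfile Rc cf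
    have h3 := idxEnergy_le_nnFormZ hχ (idxBall 0 Rc)
    have h4 : ∑ k ∈ Finset.range (2 * Rc), ‖cf ((k : ℤ) - Rc + 1) - cf ((k : ℤ) - Rc)‖ ^ 2 =
        ∑ k ∈ Finset.range (2 * Rc), (fun α => ‖cf (α + 1) - cf α‖ ^ 2) ((k : ℤ) - Rc) := rfl
    rw [h4] at h2
    exact (mul_le_mul_of_nonneg_left h1 (sq_nonneg _)).trans (h2.trans h3)
  -- (iii) combine
  have hsgn : 0 ≤ 2 * κ₀ - ε := by linarith
  have := mul_le_mul_of_nonneg_left hlow hsgn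
  push_cast at this hco hrest ⊢
  linarith

/-- ★★ CHAIN COERCIVITY FROM `CoerciveZ`, general layer sets (brick (b1) of (LD′), critic rows 915/919): if the layered crystal's kernel is
`CoerciveZ` with constant `κ₀` and its `ϱ`-tails are `ε`-dominated on finitely supported fields, then for every finitely supported profile `cf`
(support `S`) and every layer set `W ⊇ S` closed under the band `c|β − α| ≤ ϱ` around `S`, the CHAIN FORM dominates the cross-layer increments:
`(2κ₀ − ε) · Σ_{α ∈ T} ‖cf (α+1) − cf α‖² ≤ Σ_{α, β ∈ W} ⟪cf β − cf α, chainK (0, α) β (cf β − cf α)⟫` for every finite `T`.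
Proof: `chain_finiteVolume_ineq` for all large `ρ` and an Archimedean contradiction. [this file, g57] -/
theorem chainCoercive_of_coerciveZ_sum (hc : 0 < c) (hL : IsLayeredCrystal c a b w) {κ₀ ε ϱ : ℝ} (hϱ : 0 ≤ ϱ) (hε : ε ≤ 2 * κ₀)
    (hK : CoerciveZ (layeredKernel a b w) κ₀)
    (hT : ∀ φ : Cell 2 → ℤ → E3, HasFiniteSupport φ → Summable (tailFam ϱ a b w φ) ∧ ∑' x, tailFam ϱ a b w φ x ≤ ε * nnFormZ φ)
    (cf : ℤ → E3) {S W : Finset ℤ} (hS : ∀ α, α ∉ S → cf α = 0) (hSW : S ⊆ W)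
    (hW : ∀ α ∈ S, ∀ β : ℤ, c * |(((β - α : ℤ)) : ℝ)| ≤ ϱ → β ∈ W) (T : Finset ℤ) :
    (2 * κ₀ - ε) * ∑ α ∈ T, ‖cf (α + 1) - cf α‖ ^ 2 ≤ ∑ α ∈ W, ∑ β ∈ W, chainT ϱ a b w cf α β := by
  set r := ⌊ϱ / c⌋₊ with hr
  set D := ∑ α ∈ T, ‖cf (α + 1) - cf α‖ ^ 2 with hDdef
  set Q := ∑ α ∈ W, ∑ β ∈ W, chainT ϱ a b w cf α β with hQdef
  set m := ∑ α ∈ S, ‖cf α‖ with hmdef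
  have hm : ∀ α, ‖cf α‖ ≤ m := by
    intro α
    by_cases h : α ∈ S
    · exact single_le_sum (f := fun α => ‖cf α‖) (fun β _ => norm_nonneg _) h
    · rw [hS α h, norm_zero]; exact sum_nonneg fun β _ => norm_nonneg _
  set M := (((8 * r * (layerCollar S r).card : ℕ)) : ℝ) * ((((2 * r + 1) ^ 3 : ℕ) : ℝ) * (kernelConst c * (2 * m) ^ 2)) with hMdef
  have hM0 : 0 ≤ M :=
    mul_nonneg (Nat.cast_nonneg _) (mul_nonneg (Nat.cast_nonneg _) (mul_nonneg (kernelConst_nonneg hc) (sq_nonneg _)))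
  set ρ₀ := ∑ α ∈ S, (α.natAbs + 1) with hρ₀
  have hρ₀S : ∀ ρ, ρ₀ ≤ ρ → ∀ α ∈ S, α.natAbs + 1 ≤ ρ := fun ρ hρ α hα =>
    (single_le_sum (f := fun α : ℤ => α.natAbs + 1) (fun β _ => Nat.zero_le _) hα).trans hρ
  -- the finite-volume inequality, rewritten as `(2R_c+1)·[(2κ₀−ε)D − Q]·(2R_c+1) ≤ …`
  have hineq : ∀ ρ : ℕ, ρ₀ ≤ ρ →
      (2 * κ₀ - ε) * ((2 * ((ρ : ℝ) + r) + 1) ^ 2 * D) ≤ (2 * (ρ : ℝ) + 1) ^ 2 * Q + M * (2 * ((ρ : ℝ) + r) + 1) := by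
    intro ρ hρ
    have h := chain_finiteVolume_ineq hc hL hϱ hε hK hT hS hSW hW hm T (hρ₀S ρ hρ)
    push_cast at h ⊢
    have hMid : (8 * (r : ℝ) * (2 * ρ + 2 * r + 1) * (layerCollar S r).card) * ((2 * (r : ℝ) + 1) ^ 3 * (kernelConst c * (2 * m) ^ 2)) =
        M * (2 * ((ρ : ℝ) + r) + 1) := by rw [hMdef]; push_cast; ring
    linarith
  by_contra hlt
  rw [not_le] at hlt
  set δ := (2 * κ₀ - ε) * D - Q with hδdef
  have hδ : 0 < δ := by rw [hδdef]; linarith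
  -- for every large ρ: `(2R_c+1) δ ≤ 4 r |Q| + M`
  have hkey : ∀ ρ : ℕ, ρ₀ ≤ ρ → (2 * ((ρ : ℝ) + r) + 1) * δ ≤ 4 * r * |Q| + M := by
    intro ρ hρ
    have h := hineq ρ hρ
    have hRpos : 0 < 2 * ((ρ : ℝ) + r) + 1 := by positivity
    have hQabs := le_abs_self Q
    have hQabs' := neg_abs_le Q
    have hr0 : (0 : ℝ) ≤ r := Nat.cast_nonneg r
    have hρ0 : (0 : ℝ) ≤ ρ := Nat.cast_nonneg ρ
    -- `(2R_c+1)² δ = (2R_c+1)²((2κ₀−ε)D − Q) ≤ ((2ρ+1)² − (2R_c+1)²) Q + M (2R_c+1) ≤ 4r(2R_c+1)|Q| + M(2R_c+1)`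
    have hsq : (2 * ((ρ : ℝ) + r) + 1) ^ 2 - (2 * (ρ : ℝ) + 1) ^ 2 = 4 * r * (2 * ρ + r + 1) := by ring
    have hexp : (2 * ((ρ : ℝ) + r) + 1) ^ 2 * δ ≤ (2 * ((ρ : ℝ) + r) + 1) * (4 * r * |Q| + M) := by
      have h1 : (2 * ((ρ : ℝ) + r) + 1) ^ 2 * δ ≤ ((2 * (ρ : ℝ) + 1) ^ 2 - (2 * ((ρ : ℝ) + r) + 1) ^ 2) * Q + M * (2 * ((ρ : ℝ) + r) + 1) := by
        rw [hδdef]; nlinarith [h]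
      have h2 : ((2 * (ρ : ℝ) + 1) ^ 2 - (2 * ((ρ : ℝ) + r) + 1) ^ 2) * Q ≤ 4 * r * (2 * ρ + r + 1) * |Q| := by
        have : ((2 * (ρ : ℝ) + 1) ^ 2 - (2 * ((ρ : ℝ) + r) + 1) ^ 2) * Q = -(4 * r * (2 * ρ + r + 1)) * Q := by ring
        rw [this, neg_mul, ← mul_neg]
        exact mul_le_mul_of_nonneg_left (neg_le_abs Q) (by positivity)
      have h3 : 4 * (r : ℝ) * (2 * ρ + r + 1) * |Q| ≤ (2 * ((ρ : ℝ) + r) + 1) * (4 * r * |Q|) := by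
        have hle : (2 * (ρ : ℝ) + r + 1) ≤ 2 * ((ρ : ℝ) + r) + 1 := by linarith
        calc 4 * (r : ℝ) * (2 * ρ + r + 1) * |Q| = (4 * r * |Q|) * (2 * (ρ : ℝ) + r + 1) := by ring
          _ ≤ (4 * r * |Q|) * (2 * ((ρ : ℝ) + r) + 1) := mul_le_mul_of_nonneg_left hle (by positivity)
          _ = (2 * ((ρ : ℝ) + r) + 1) * (4 * r * |Q|) := by ring
      linarith [h1, h2, h3]
    rw [pow_two, mul_assoc] at hexp
    exact le_of_mul_le_mul_left hexp hRpos
  -- Archimedes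
  obtain ⟨n, hn⟩ := exists_nat_gt ((4 * r * |Q| + M) / δ)
  have hρ := hkey (max ρ₀ n) (le_max_left _ _)
  have hn' : (n : ℝ) ≤ ((max ρ₀ n : ℕ) : ℝ) := by exact_mod_cast le_max_right ρ₀ n
  have hr0 : (0 : ℝ) ≤ r := Nat.cast_nonneg r
  have hlt' : (4 * r * |Q| + M) / δ < 2 * ((((max ρ₀ n : ℕ)) : ℝ) + r) + 1 := by linarith
  rw [div_lt_iff₀ hδ] at hlt'
  linarith

/-- ★★ CHAIN COERCIVITY FROM `CoerciveZ` — the signature of record (critic row 923 (iii)): for every finitely supported profile `cf` with `supp cf ⊆ S`,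
`(2κ₀ − ε) · chainDirichlet S cf ≤ chainForm c ϱ a b w S cf` (the left side counts EVERY nearest-layer increment of `cf`, the right side is the chain
quadratic form over the band collar of `S`; sharp constant `18(2κ₀ − ε)` not recorded). [this file, g57] -/
theorem chainCoercive_of_coerciveZ (hc : 0 < c) (hL : IsLayeredCrystal c a b w) {κ₀ ε ϱ : ℝ} (hϱ : 0 ≤ ϱ) (hε : ε ≤ 2 * κ₀)
    (hK : CoerciveZ (layeredKernel a b w) κ₀)
    (hT : ∀ φ : Cell 2 → ℤ → E3, HasFiniteSupport φ → Summable (tailFam ϱ a b w φ) ∧ ∑' x, tailFam ϱ a b w φ x ≤ ε * nnFormZ φ)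
    (S : Finset ℤ) (cf : ℤ → E3) (hcf : ∀ α, α ∉ S → cf α = 0) :
    (2 * κ₀ - ε) * chainDirichlet S cf ≤ chainForm c ϱ a b w S cf := by
  rw [chainForm_eq_sum hc hL hcf (subset_layerCollar S _) fun α hα β h => mem_layerCollar_of_band hc hα β h]
  exact chainCoercive_of_coerciveZ_sum hc hL hϱ hε hK hT cf hcf (subset_layerCollar S _)
    (fun α hα β h => mem_layerCollar_of_band hc hα β h) _

end ChainCoerciveIII

end Summit.AtomisticToContinuum.Crystallization.Theorems.ChartedZeroExcessLayeredLatticeLiouville
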